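import Literature.AlgebraicGeometry.ModuliOfAbelianVarieties.Lan2013.Sec11PreliminariesAlgebra
import HarnessLib

/-!
# Lan 2013, §1.1.1 — discharges (`_holds`) for the statement carpet `Sec11PreliminariesAlgebra`

Theorem-only companion (squad TS ruling TS-1; cell hodgecm-mathlib, seat TS-t06 (g3)) of
`Literature/AlgebraicGeometry/ModuliOfAbelianVarieties/Lan2013/Sec11PreliminariesAlgebra.lean` (§1.1.1 «Lattices and
orders»).  Declarations live in the carpet's namespace, so that the discharge of the named fact `Lan2013_1115` is literally
`Lan2013_1115_holds`.  THEOREMS ONLY: no `def`, no new named fact, no `sorry`, no `instance`, no notation; net debt −1.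

* `Lan2013_1115_holds : Lan2013_1115` — **Proposition 1.1.1.5** [Lan2013PELCompactifications, Prop. 1.1.1.5 (p. 2; 2010
  rev. pp. 2–3)] = [102 = Reiner, *Maximal Orders*, Thm. 8.7], by Reiner's proof:
  (1) every element of an `R`-order is integral over `R` (an order is a finitely generated `R`-module,
  `IsIntegral.of_mem_of_fg`), so an order containing the integral closure is contained in it — the integral closure, when
  an order, is maximal (`isMaximalOrder_of_coe_eq_setOf_isIntegral`);
  (2) if `O' ⊇ M_n(𝒪)` is an `R`-order in `M_n(A)`, its pre-image `Γ = {a ∈ A : a·1_n ∈ O'}` under the scalar embedding is an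
  `R`-order of `A` (finitely generated because `R` is noetherian and `a ↦ a·1_n` is injective into the finitely generated `O'`;
  spanning because `𝒪 ⊆ Γ`), hence `Γ = 𝒪` by maximality, and every entry `x i j` of `x ∈ O'` lies in `Γ` because
  `(x i j)·1_n = ∑ₖ e_{k i} x e_{j k} ∈ O'` — so `O' = M_n(𝒪)` (`isMaximalOrder_matrix`);
  (3) for `R` normal, `R = ⊥ ⊆ K` is an `R`-order equal to the integral closure of `R` in `K`, hence maximal by (1), and
  `M_n(R)` is maximal by (2) (`isMaximalOrder_bot`).
  The hypotheses `IsDomain R`, `FiniteDimensional K A` of the printed statement are carried but not used beyond what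
  `IsFractionRing` ∕ the orders themselves provide.

ED. 2 (append protocol) adds the DISCHARGE of **Remark 1.1.1.7** and the integrality of reduced traces it rests on:

* `IsReducedTrace.isIntegral_apply` ∕ `IsReducedTrace.apply_mem_range` — the input the carpet's docstrings name («`R`
  normal, so that reduced traces of integral elements lie in `R`», rev. p. 3), PROVED: after a splitting
  `L ⊗_K A ≃ ∏ᵢ M_{nᵢ}(L)` (`IsReducedTrace`), `Tr a` is the sum of the traces of matrices annihilated by the monic polynomial of
  the integral element `a`; such a trace is the sum of the eigenvalues in an algebraic closure
  (`Matrix.trace_eq_sum_roots_charpoly`), each of which is a root of that polynomial (`Matrix.mem_spectrum_iff_isRoot_charpoly`,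
  `spectrum.subset_polynomial_aeval`), hence integral (`isIntegral_trace_of_aeval_eq_zero`); over a normal domain an integral
  element of `K = Frac(R)` lies in `R` (`IsIntegrallyClosed.isIntegral_iff`).
* `Lan2013_1117_holds : Lan2013_1117` — **Remark 1.1.1.7** [Lan2013PELCompactifications, Rem. 1.1.1.7 (p. 2; 2010 rev.
  p. 3)]: for `x₁, …, x_t ∈ 𝒪` with `xᵢ = ∑ₖ cᵢₖ eₖ` in the `R`-basis `e`, `(Tr(xᵢ xⱼ)) = C · (Tr(eₖ eₗ)) · Cᵀ`, so every generator
  of `Disc_{𝒪/R}` is `det(C)² · det(Tr(eₖ eₗ))`, and `det(Tr(eₖ eₗ)) ∈ R` by the previous item; hence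
  `Disc_{𝒪/R} = (det(Tr(eₖ eₗ)))`.  (The hypothesis `IsSeparableAlgebra K A` is carried, not used.)  Net debt −1.

ED. 3 (append protocol) adds the DISCHARGE of **Lemma 1.1.1.9**:

* `IsReducedTrace.apply_mul_comm`, `IsReducedTrace.eq_zero_of_forall_apply_mul_eq_zero` — the reduced trace form
  `(x, y) ↦ Tr(xy)` is symmetric and nondegenerate (rev. p. 3: «the (reduced) trace pairing … is non-degenerate»,
  [102, Thm. 9.26]); here both follow from the splitting `L ⊗_K A ≃ ∏ M_{nᵢ}(L)` of `IsReducedTrace` (matrix trace forms are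
  symmetric and nondegenerate; `A → L ⊗_K A` is injective, Mathlib `Algebra.TensorProduct.includeRight_injective`).
* `Lan2013_1119_holds : Lan2013_1119` — **Lemma 1.1.1.9** [Lan2013PELCompactifications, Lem. 1.1.1.9 (p. 3; 2010 rev.
  pp. 3–4)]: `y ↦ Tr(· y)` is a `K`-isomorphism `A ≅ A^*` (nondegeneracy + `Subspace.dual_finrank_eq`); an `R`-functional on
  the order `𝒪` extends to a `K`-functional on `A` (a `K`-basis of `A` inside `𝒪`, denominators cleared by
  `IsLocalization.exist_integer_multiples`), so `z ↦ Tr(· z)` is an `R`-isomorphism `Diff⁻¹ ≅ Hom_R(𝒪, R)` — whence `Diff⁻¹`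
  is finitely generated projective (Mathlib `dual_finite`, `dual_projective`) and `Tr : 𝒪 × Diff⁻¹ → R` represents every
  functional on `𝒪` uniquely; the converse representation is the reflexivity of the finitely generated projective `𝒪`
  (`Module.evalEquiv`), and the `Tr`-dual basis of an `R`-basis `e` of `𝒪` is `e.dualBasis` transported, unique by
  `Module.Basis.ext`.  (`IsSeparableAlgebra K A` is again carried, not used.)  Net debt −1.

ED. 4 (append protocol) adds the DISCHARGE of **Proposition 1.1.1.16** (`Lan2013_11116_holds`, `R` Dedekind): `Diff ⊆ 𝒪`
because `1 ∈ Diff⁻¹` (`IsReducedTrace.apply_mem_range`), `Diff` is two-sided because `Diff⁻¹` is a two-sided `𝒪`-module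
(symmetry of the trace form), and (1.1.1.17) in the free form of Lan's proof: with `eᵢ = ∑ⱼ aᵢⱼ fⱼ` for the `Tr`-dual bases
`e`, `f`, the Gram matrix `(Tr(eᵢ eⱼ))` IS `a`, so `Disc_{𝒪/R} = (det a)` by Remark 1.1.1.7 (`Lan2013_1117_holds`, after
re-indexing `e` by `Fin [A : K]`: an `R`-basis of the full lattice `𝒪` is a `K`-basis of `A`, `LinearIndependent.iff_fractionRing`).
Net debt −1.

## References
[Lan2013PELCompactifications] K.-W. Lan, *Arithmetic compactifications of PEL-type Shimura varieties*, LMS Monographs 36,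
Princeton UP 2013, Prop. 1.1.1.5 (p. 2; 2010 rev. pp. 2–3, held text `paper:doi-10-1515-9781400846016` p0030–p0031).
[102] I. Reiner, *Maximal Orders*, Thm. 8.7 (quoted through Lan).
-/

open scoped TensorProduct
open Polynomial

namespace Literature.AlgebraicGeometry.ModuliOfAbelianVarieties.Lan2013.Sec11PreliminariesAlgebra

universe u

section Holds1115

variable {R : Type*} [CommRing R] {K : Type*} [Field K] [Algebra R K]
variable {A : Type*} [Ring A] [Algebra K A] [Algebra R A] [IsScalarTower R K A]

/-- **Prop. 1.1.1.5 (1)**: an `R`-order whose carrier is the set of `R`-integral elements of `A` is maximal — every element of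
an `R`-order is integral, an order being a finitely generated `R`-module.
[cite: Lan2013PELCompactifications, Prop. 1.1.1.5 (p. 2; 2010 rev. p. 2)] -/
theorem isMaximalOrder_of_coe_eq_setOf_isIntegral (O : Subalgebra R A) (hO : (O : Set A) = {a : A | IsIntegral R a})
    (hord : IsOrder R K A O) : IsMaximalOrder R K A O := by
  refine ⟨hord, fun O' hO' hle => le_antisymm (fun a ha => ?_) hle⟩
  haveI : Submodule.IsLattice K (Subalgebra.toSubmodule O') := hO'
  have hint : IsIntegral R a :=
    IsIntegral.of_mem_of_fg O' (Submodule.IsLattice.fg (M := Subalgebra.toSubmodule O')) a ha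
  have hmem : a ∈ (O : Set A) := by
    rw [hO]
    exact hint
  exact hmem

variable {ι : Type*} [Fintype ι] [DecidableEq ι]

/-- Membership in `Subalgebra.matrix` is entrywise. [folklore] -/
private theorem mem_matrix_iff {O : Subalgebra R A} {x : Matrix ι ι A} :
    x ∈ (O.matrix : Subalgebra R (Matrix ι ι A)) ↔ ∀ i j, x i j ∈ O :=
  Iff.rfl

/-- Elementary matrices with entry in `𝒪` lie in `M_n(𝒪)`. [folklore] -/
private theorem single_mem_matrix {O : Subalgebra R A} (i j : ι) {a : A} (ha : a ∈ O) :
    Matrix.single i j a ∈ (O.matrix : Subalgebra R (Matrix ι ι A)) := by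
  rw [mem_matrix_iff]
  intro i' j'
  rw [Matrix.single_apply]
  split_ifs
  · exact ha
  · exact O.zero_mem

/-- `M_n(𝒪)` is an `R`-order of `M_n(A)` when `𝒪` is an `R`-order of `A` (the first half of Prop. 1.1.1.5 (2): entrywise
generators, entrywise spanning). [cite: Lan2013PELCompactifications, Prop. 1.1.1.5 (p. 2; 2010 rev. pp. 2–3)] -/
theorem isOrder_matrix {O : Subalgebra R A} (hord : IsOrder R K A O) :
    IsOrder R K (Matrix ι ι A) (O.matrix : Subalgebra R (Matrix ι ι A)) := by
  haveI : Submodule.IsLattice K (Subalgebra.toSubmodule O) := hord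
  -- the entrywise inclusion `(ι → ι → 𝒪) → M_n(A)`
  let f : (ι → ι → Subalgebra.toSubmodule O) →ₗ[R] Matrix ι ι A :=
    (Matrix.ofLinearEquiv R : (ι → ι → A) ≃ₗ[R] Matrix ι ι A).toLinearMap ∘ₗ
      (((Subalgebra.toSubmodule O).subtype.compLeft ι).compLeft ι)
  have hrange : Subalgebra.toSubmodule (O.matrix : Subalgebra R (Matrix ι ι A)) = LinearMap.range f := by
    apply le_antisymm
    · intro x hx
      refine ⟨fun i j => ⟨x i j, hx i j⟩, ?_⟩
      ext i j
      rfl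
    · rintro _ ⟨y, rfl⟩ i j
      exact (y i j).2
  refine ⟨?_, ?_⟩
  · rw [hrange, LinearMap.range_eq_map]
    exact Module.Finite.fg_top.map f
  · rw [eq_top_iff]
    rintro x -
    rw [Matrix.matrix_eq_sum_single x]
    refine Submodule.sum_mem _ fun i _ => Submodule.sum_mem _ fun j _ => ?_
    have hx : x i j ∈ Submodule.span K ((Subalgebra.toSubmodule O : Submodule R A) : Set A) := by
      rw [Submodule.IsLattice.span_eq_top (M := Subalgebra.toSubmodule O)]
      trivial
    have hle : (Submodule.span K ((Subalgebra.toSubmodule O : Submodule R A) : Set A)).map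
        (Matrix.singleLinearMap K i j) ≤
        Submodule.span K ((Subalgebra.toSubmodule (O.matrix : Subalgebra R (Matrix ι ι A)) :
          Submodule R (Matrix ι ι A)) : Set (Matrix ι ι A)) := by
      rw [Submodule.map_span, Submodule.span_le]
      rintro _ ⟨a, ha, rfl⟩
      exact Submodule.subset_span (single_mem_matrix i j ha)
    exact hle ⟨x i j, hx, rfl⟩

/-- **Prop. 1.1.1.5 (2)** [102, Thm. 8.7]: `M_n(𝒪)` is a maximal `R`-order of `M_n(A)` when `𝒪` is a maximal `R`-order of `A`
(`R` noetherian, `n ≥ 1`).  Reiner's proof: the scalar pre-image `Γ` of an order `O' ⊇ M_n(𝒪)` is an order containing `𝒪`,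
so `Γ = 𝒪`, and the entries of `O'` lie in `Γ` because `(x i j)·1_n = ∑ₖ e_{k i} x e_{j k}`.
[cite: Lan2013PELCompactifications, Prop. 1.1.1.5 (p. 2; 2010 rev. pp. 2–3)] -/
theorem isMaximalOrder_matrix [IsNoetherianRing R] [Nonempty ι] {O : Subalgebra R A}
    (hO : IsMaximalOrder R K A O) :
    IsMaximalOrder R K (Matrix ι ι A) (O.matrix : Subalgebra R (Matrix ι ι A)) := by
  obtain ⟨hord, hmax⟩ := hO
  refine ⟨isOrder_matrix hord, fun O' hO' hle => le_antisymm ?_ hle⟩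
  haveI : Submodule.IsLattice K (Subalgebra.toSubmodule O) := hord
  haveI hO'i : Submodule.IsLattice K (Subalgebra.toSubmodule O') := hO'
  -- the scalar embedding `a ↦ a·1_n` and the pre-image `Γ` of `O'`
  let φ : A →ₐ[R] Matrix ι ι A := Matrix.scalarAlgHom ι R
  have hφ : Function.Injective φ := fun a b h => Matrix.scalar_inj.mp h
  let Γ : Subalgebra R A := O'.comap φ
  have hΓmem : ∀ a : A, a ∈ Γ ↔ φ a ∈ O' := fun a => Subalgebra.mem_comap _ _ _
  -- `𝒪 ⊆ Γ`
  have hOΓ : O ≤ Γ := by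
    intro a ha
    rw [hΓmem]
    refine hle ?_
    rw [mem_matrix_iff]
    intro i j
    change (Matrix.scalar ι a) i j ∈ O
    rw [Matrix.scalar_apply, Matrix.diagonal_apply]
    split_ifs
    · exact ha
    · exact O.zero_mem
  -- `Γ` is an `R`-order
  have hΓord : IsOrder R K A Γ := by
    refine ⟨?_, ?_⟩
    · -- finitely generated: `Γ ↪ O'` by `φ`, `O'` finitely generated over the noetherian `R`
      let g : Subalgebra.toSubmodule Γ →ₗ[R] Subalgebra.toSubmodule O' :=
        φ.toLinearMap.restrict (p := Subalgebra.toSubmodule Γ) (q := Subalgebra.toSubmodule O')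
          (fun a ha => (hΓmem a).mp ha)
      have hg : Function.Injective g := by
        intro a b h
        apply Subtype.ext
        apply hφ
        have := congrArg Subtype.val h
        simpa [g, LinearMap.restrict_apply] using this
      have hfin : Module.Finite R (Subalgebra.toSubmodule Γ) := Module.Finite.of_injective g hg
      exact Module.Finite.iff_fg.mp hfin
    · rw [eq_top_iff, ← Submodule.IsLattice.span_eq_top (M := Subalgebra.toSubmodule O)]
      exact Submodule.span_mono hOΓ
  -- maximality of `𝒪`
  have hΓ : Γ = O := hmax Γ hΓord hOΓ
  -- every entry of `x ∈ O'` lies in `Γ = 𝒪`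
  intro x hx
  rw [mem_matrix_iff]
  intro i j
  have hij : x i j ∈ Γ := by
    rw [hΓmem]
    have hx' : φ (x i j) = ∑ k, Matrix.single k i 1 * x * Matrix.single j k 1 := by
      ext a b
      change (Matrix.scalar ι (x i j)) a b = _
      simp only [Matrix.scalar_apply, Matrix.diagonal_apply, Matrix.single_mul_mul_single, one_mul, mul_one,
        Matrix.sum_apply, Matrix.single_apply]
      by_cases hab : a = b
      · subst hab
        simp
      · rw [if_neg hab]
        refine (Finset.sum_eq_zero fun k _ => ?_).symm
        rw [if_neg]
        rintro ⟨rfl, rfl⟩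
        exact hab rfl
    rw [hx']
    refine Subalgebra.sum_mem _ fun k _ => ?_
    exact Subalgebra.mul_mem _ (Subalgebra.mul_mem _ (hle (single_mem_matrix k i O.one_mem)) hx)
      (hle (single_mem_matrix j k O.one_mem))
  rwa [hΓ] at hij

/-- **Prop. 1.1.1.5 (3), first half**: for `R` normal with fraction field `K`, `R = ⊥ ⊆ K` is a maximal `R`-order of `K`
(it is an order whose carrier is the integral closure of `R` in `K`).
[cite: Lan2013PELCompactifications, Prop. 1.1.1.5 (p. 2; 2010 rev. p. 3)] -/
theorem isMaximalOrder_bot [IsFractionRing R K] [IsIntegrallyClosed R] :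
    IsMaximalOrder R K K (⊥ : Subalgebra R K) := by
  refine isMaximalOrder_of_coe_eq_setOf_isIntegral (K := K) ⊥ ?_ ?_
  · ext x
    simp only [SetLike.mem_coe, Algebra.mem_bot, Set.mem_range, Set.mem_setOf_eq]
    exact (IsIntegrallyClosed.isIntegral_iff (R := R) (K := K)).symm
  · refine ⟨?_, ?_⟩
    · rw [Algebra.toSubmodule_bot, Submodule.one_eq_span]
      exact Submodule.fg_span_singleton 1
    · rw [eq_top_iff]
      rintro x -
      have h1 : (1 : K) ∈ ((Subalgebra.toSubmodule (⊥ : Subalgebra R K) : Submodule R K) : Set K) :=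
        Subalgebra.one_mem _
      have hx : x • (1 : K) ∈ Submodule.span K
          ((Subalgebra.toSubmodule (⊥ : Subalgebra R K) : Submodule R K) : Set K) :=
        Submodule.smul_mem _ x (Submodule.subset_span h1)
      simpa using hx

end Holds1115

/-- **Proposition 1.1.1.5 HOLDS** (discharge of `Lan2013_1115`; [102, Thm. 8.7]): (1) the integral closure of `R` in `A`, if an
`R`-order, is maximal; (2) `M_n(𝒪)` is a maximal `R`-order in `M_n(A)` for `𝒪` maximal and `n ≥ 1`; (3) `M_n(R)` is a maximal
`R`-order in `M_n(Frac R)` for `R` normal. [cite: Lan2013PELCompactifications, Prop. 1.1.1.5 (p. 2; 2010 rev. pp. 2–3)] -/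
theorem Lan2013_1115_holds : Lan2013_1115.{u} := by
  intro R _ _ _ K _ _ _ A _ _ _ _ _
  refine ⟨fun O hO hord => isMaximalOrder_of_coe_eq_setOf_isIntegral O hO hord, fun O n hn hO => ?_,
    fun n hn _ => ?_⟩
  · haveI : Nonempty (Fin n) := ⟨⟨0, hn⟩⟩
    exact isMaximalOrder_matrix hO
  · haveI : Nonempty (Fin n) := ⟨⟨0, hn⟩⟩
    exact isMaximalOrder_matrix isMaximalOrder_bot

section Holds1117

/-- A matrix over a field annihilated by a monic polynomial with coefficients in `R` has `R`-integral trace (its trace is the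
sum of its eigenvalues in an algebraic closure, each a root of the polynomial). [folklore] -/
private theorem isIntegral_trace_of_aeval_eq_zero {R : Type*} [CommRing R] {L : Type*} [Field L] [Algebra R L]
    {n : Type*} [Fintype n] [DecidableEq n] (m : Matrix n n L) {p : R[X]} (hp : p.Monic)
    (hm : aeval m p = 0) : IsIntegral R m.trace := by
  rcases isEmpty_or_nonempty n with hn | hn
  · have : m.trace = 0 := by simp [Matrix.trace]
    rw [this]
    exact isIntegral_zero
  let Lb := AlgebraicClosure L
  let φ : Matrix n n L →ₐ[R] Matrix n n Lb := ((Algebra.ofId L Lb).restrictScalars R).mapMatrix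
  have hφ : φ m = m.map (algebraMap L Lb) := rfl
  -- the trace of `m` maps to the trace of `φ m`
  have htr : algebraMap L Lb m.trace = (φ m).trace := by
    rw [hφ]
    simp [Matrix.trace, Matrix.map_apply, map_sum]
  -- `φ m` is annihilated by `p`
  have hm' : aeval (φ m) p = 0 := by
    rw [Polynomial.aeval_algHom_apply, hm, map_zero]
  -- every eigenvalue of `φ m` is a root of `p`, hence integral
  have hroots : ∀ μ ∈ (φ m).charpoly.roots, IsIntegral R μ := by
    intro μ hμ
    have hroot : IsRoot (φ m).charpoly μ := (Polynomial.mem_roots (Matrix.charpoly_monic _).ne_zero).mp hμ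
    have hspec : μ ∈ spectrum Lb (φ m) := Matrix.mem_spectrum_iff_isRoot_charpoly.mpr hroot
    have hsub := spectrum.subset_polynomial_aeval (φ m) (p.map (algebraMap R Lb))
    have hmem : eval μ (p.map (algebraMap R Lb)) ∈ spectrum Lb (aeval (φ m) (p.map (algebraMap R Lb))) :=
      hsub ⟨μ, hspec, rfl⟩
    rw [Polynomial.aeval_map_algebraMap, hm', spectrum.zero_eq, Set.mem_singleton_iff, Polynomial.eval_map] at hmem
    exact ⟨p, hp, hmem⟩
  have hint : IsIntegral R (φ m).trace := by
    rw [Matrix.trace_eq_sum_roots_charpoly]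
    exact IsIntegral.multiset_sum hroots
  rw [← htr] at hint
  exact (isIntegral_algHom_iff (IsScalarTower.toAlgHom R L Lb) (algebraMap L Lb).injective).mp hint

variable {R : Type*} [CommRing R] {K : Type*} [Field K] [Algebra R K]
variable {A : Type*} [Ring A] [Algebra K A] [Algebra R A] [IsScalarTower R K A]

/-- **The reduced trace of an `R`-integral element is integral over `R`** (used implicitly throughout §1.1.1, rev. p. 3:
«`Disc`» and «`Diff⁻¹`» are formed with `Tr_{A/Frac(R)}` of elements of an order): after a splitting
`L ⊗_K A ≃ ∏ M_{nᵢ}(L)`, `Tr a` is a sum of traces of matrices annihilated by the monic polynomial of `a`.  This is the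
integrality tacit in Def. 1.1.1.6 («the ideal of `R` generated by the set of elements `{Det(Tr(xᵢxⱼ))}`», Lan's source being
[102 = Reiner, *Maximal Orders*, Ch. 10]). [cite: Lan2013PELCompactifications, Def. 1.1.1.6 (pp. 2–3; 2010 rev. p. 3)] -/
theorem IsReducedTrace.isIntegral_apply {Tr : A →ₗ[K] K} (hTr : IsReducedTrace K A Tr) {a : A}
    (ha : IsIntegral R a) : IsIntegral R (Tr a) := by
  obtain ⟨L, _instF, _instA, ι, _instι, n, e, he⟩ := hTr
  letI : Algebra R L := ((algebraMap K L).comp (algebraMap R K)).toAlgebra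
  haveI : IsScalarTower R K L := IsScalarTower.of_algebraMap_eq (fun _ => rfl)
  obtain ⟨p, hp, hpa⟩ := ha
  have hpa' : aeval a p = 0 := by rwa [Polynomial.aeval_def]
  have key : IsIntegral R (algebraMap K L (Tr a)) := by
    rw [he a]
    refine IsIntegral.sum _ fun i _ => ?_
    -- the `K`-algebra map `A → M_{nᵢ}(L)`, `a ↦ e (1 ⊗ a) i`
    let ψ : A →ₐ[K] Matrix (Fin (n i)) (Fin (n i)) L :=
      ((Pi.evalAlgHom L (fun i => Matrix (Fin (n i)) (Fin (n i)) L) i).restrictScalars K).comp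
        (((e : L ⊗[K] A ≃ₐ[L] (Π i, Matrix (Fin (n i)) (Fin (n i)) L)).toAlgHom.restrictScalars K).comp
          (Algebra.TensorProduct.includeRight))
    have hψ : ψ a = e (1 ⊗ₜ[K] a) i := rfl
    have hK : aeval (ψ a) (p.map (algebraMap R K)) = 0 := by
      rw [Polynomial.aeval_algHom_apply, Polynomial.aeval_map_algebraMap, hpa', map_zero]
    rw [Polynomial.aeval_map_algebraMap, hψ] at hK
    exact isIntegral_trace_of_aeval_eq_zero _ hp hK
  exact (isIntegral_algHom_iff (IsScalarTower.toAlgHom R K L) (algebraMap K L).injective).mp key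

/-- Over a normal domain `R` with fraction field `K`, the reduced trace of an `R`-integral element lies in `R` — the form in
which Def. 1.1.1.6 uses it («`Disc_{𝒪/R}` is the ideal of `R` generated by …»; [102, Ch. 10]).
[cite: Lan2013PELCompactifications, Def. 1.1.1.6 (pp. 2–3; 2010 rev. p. 3)] -/
theorem IsReducedTrace.apply_mem_range [IsFractionRing R K] [IsIntegrallyClosed R] {Tr : A →ₗ[K] K}
    (hTr : IsReducedTrace K A Tr) {a : A} (ha : IsIntegral R a) : Tr a ∈ Set.range (algebraMap R K) :=
  IsIntegrallyClosed.isIntegral_iff.mp (hTr.isIntegral_apply ha)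


/-- **Remark 1.1.1.7 HOLDS** (discharge of `Lan2013_1117`): for an `R`-order `𝒪` with `R`-basis `e₁, …, e_t`
(`t = [A : Frac(R)]`), `Disc_{𝒪/R}` is generated by the single element `det(Tr(eᵢ eⱼ))`.  Proof: for `x₁, …, x_t ∈ 𝒪` write
`xᵢ = ∑ₖ cᵢₖ eₖ` (`cᵢₖ ∈ R`); then `(Tr(xᵢ xⱼ)) = C (Tr(eₖ eₗ)) Cᵀ`, so `det(Tr(xᵢ xⱼ)) = det(C)² det(Tr(eₖ eₗ))`; and
`det(Tr(eₖ eₗ)) ∈ R` because reduced traces of elements of an order are integral over the normal domain `R`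
(`IsReducedTrace.apply_mem_range`). [cite: Lan2013PELCompactifications, Rem. 1.1.1.7 (p. 2; 2010 rev. p. 3)] -/
theorem Lan2013_1117_holds : Lan2013_1117.{u} := by
  intro R _ _ _ K _ _ _ A _ _ _ _ _ Tr O e _ _ hTr hord
  haveI : Submodule.IsLattice K (Subalgebra.toSubmodule O) := hord
  have hfg : (Subalgebra.toSubmodule O).FG := Submodule.IsLattice.fg
  -- the Gram matrix of the basis and its determinant
  set M : Matrix (Fin (Module.finrank K A)) (Fin (Module.finrank K A)) K :=
    Matrix.of fun i j => Tr ((e i : A) * (e j : A)) with hM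
  -- Step 1: every generator of `Disc` is `det(C)² • det M`
  have hgen : ∀ x : Fin (Module.finrank K A) → A, (∀ i, x i ∈ O) →
      ∃ r : R, (Matrix.of fun i j => Tr (x i * x j)).det = r • M.det := by
    intro x hx
    let c : Matrix (Fin (Module.finrank K A)) (Fin (Module.finrank K A)) R :=
      Matrix.of fun i k => e.repr ⟨x i, hx i⟩ k
    have hxe : ∀ i, x i = ∑ k, c i k • (e k : A) := by
      intro i
      have h := congrArg (O.val : O →ₐ[R] A) (e.sum_repr ⟨x i, hx i⟩)
      rw [map_sum] at h
      simp only [map_smul, Subalgebra.coe_val] at h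
      exact h.symm
    have hmat : (Matrix.of fun i j => Tr (x i * x j)) = c.map (algebraMap R K) * M * (c.map (algebraMap R K)).transpose := by
      ext i j
      have lhs : Tr (x i * x j) = ∑ k, ∑ l, algebraMap R K (c i k) * algebraMap R K (c j l) * Tr ((e k : A) * (e l : A)) := by
        rw [hxe i, hxe j, Finset.sum_mul, map_sum]
        refine Finset.sum_congr rfl fun k _ => ?_
        rw [Finset.mul_sum, map_sum]
        refine Finset.sum_congr rfl fun l _ => ?_
        rw [smul_mul_assoc, mul_smul_comm, LinearMap.map_smul_of_tower, LinearMap.map_smul_of_tower, Algebra.smul_def,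
          Algebra.smul_def, mul_assoc]
      have rhs : (c.map (algebraMap R K) * M * (c.map (algebraMap R K)).transpose) i j =
          ∑ l, ∑ k, algebraMap R K (c i k) * algebraMap R K (c j l) * Tr ((e k : A) * (e l : A)) := by
        simp only [Matrix.mul_apply, Matrix.transpose_apply, Matrix.map_apply, hM, Matrix.of_apply, Finset.sum_mul]
        refine Finset.sum_congr rfl fun l _ => Finset.sum_congr rfl fun k _ => ?_
        ring
      rw [Matrix.of_apply, lhs, rhs, Finset.sum_comm]
    refine ⟨c.det * c.det, ?_⟩
    rw [hmat, Matrix.det_mul, Matrix.det_mul, Matrix.det_transpose, ← RingHom.mapMatrix_apply, ← RingHom.map_det,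
      Algebra.smul_def, map_mul]
    ring
  -- Step 2: the generating submodule is the span of `det M`
  have hspan : Submodule.span R {d : K | ∃ x : Fin (Module.finrank K A) → A,
      (∀ i, x i ∈ O) ∧ d = (Matrix.of fun i j => Tr (x i * x j)).det} = Submodule.span R {M.det} := by
    apply le_antisymm
    · rw [Submodule.span_le]
      rintro d ⟨x, hx, rfl⟩
      obtain ⟨r, hr⟩ := hgen x hx
      rw [SetLike.mem_coe, hr]
      exact Submodule.smul_mem _ _ (Submodule.mem_span_singleton_self _)
    · rw [Submodule.span_le, Set.singleton_subset_iff]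
      exact Submodule.subset_span ⟨fun i => (e i : A), fun i => (e i).2, rfl⟩
  -- Step 3: `det M ∈ R`, the reduced traces of the integral elements `eₖ eₗ ∈ 𝒪` lying in `R`
  have hTrR : ∀ k l, Tr ((e k : A) * (e l : A)) ∈ Set.range (algebraMap R K) := fun k l =>
    hTr.apply_mem_range (IsIntegral.of_mem_of_fg O hfg _ (O.mul_mem (e k).2 (e l).2))
  choose T hT using hTrR
  have hdet : M.det = algebraMap R K (Matrix.of T).det := by
    rw [RingHom.map_det, RingHom.mapMatrix_apply]
    congr 1
    ext k l
    simp [hM, hT]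
  -- conclusion
  unfold discr
  rw [Submodule.map_comap_eq, hspan, inf_eq_right, Submodule.span_le, Set.singleton_subset_iff, SetLike.mem_coe,
    LinearMap.mem_range]
  exact ⟨(Matrix.of T).det, hdet.symm⟩

end Holds1117

section Holds1119

variable {R : Type*} [CommRing R] {K : Type*} [Field K] [Algebra R K]
variable {A : Type*} [Ring A] [Algebra K A] [Algebra R A] [IsScalarTower R K A]

/-- The reduced trace is symmetric: `Tr(xy) = Tr(yx)` (after a splitting, `trace (MN) = trace (NM)`).
[cite: Lan2013PELCompactifications, §1.1.1 (p. 2; 2010 rev. p. 3)] -/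
theorem IsReducedTrace.apply_mul_comm {Tr : A →ₗ[K] K} (hTr : IsReducedTrace K A Tr) (x y : A) :
    Tr (x * y) = Tr (y * x) := by
  obtain ⟨L, _instF, _instA, ι, _instι, n, e, he⟩ := hTr
  apply (algebraMap K L).injective
  rw [he, he]
  refine Finset.sum_congr rfl fun i _ => ?_
  have hx : ∀ a b : A, ((1 : L) ⊗ₜ[K] (a * b) : L ⊗[K] A) = (1 : L) ⊗ₜ[K] a * (1 : L) ⊗ₜ[K] b := by
    intro a b
    rw [Algebra.TensorProduct.tmul_mul_tmul, one_mul]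
  rw [hx, hx, map_mul, map_mul, Pi.mul_apply, Pi.mul_apply, Matrix.trace_mul_comm]

/-- The reduced trace form `(x, y) ↦ Tr(xy)` is nondegenerate: if `Tr(xy) = 0` for all `y` then `x = 0` (after a splitting
`L ⊗_K A ≃ ∏ M_{nᵢ}(L)`, the `L`-linear extension of the trace form is the sum of the matrix trace forms, which are
nondegenerate; and `A → L ⊗_K A` is injective).  This is [102, Thm. 9.26] as quoted on rev. p. 3 («the (reduced) trace
pairing … is non-degenerate»), here derived from the splitting rather than from separability.
[cite: Lan2013PELCompactifications, §1.1.1 (p. 2; 2010 rev. p. 3)] -/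
theorem IsReducedTrace.eq_zero_of_forall_apply_mul_eq_zero {Tr : A →ₗ[K] K} (hTr : IsReducedTrace K A Tr) {x : A}
    (hx : ∀ y : A, Tr (x * y) = 0) : x = 0 := by
  obtain ⟨L, _instF, _instA, ι, _instι, n, e, he⟩ := hTr
  -- the `L`-linear extension of `Tr`
  let TL : L ⊗[K] A →ₗ[L] L :=
    (TensorProduct.AlgebraTensorModule.rid K L L).toLinearMap ∘ₗ (Tr.baseChange L)
  have hTL : ∀ (c : L) (a : A), TL (c ⊗ₜ[K] a) = algebraMap K L (Tr a) * c := by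
    intro c a
    change TensorProduct.AlgebraTensorModule.rid K L L (Tr.baseChange L (c ⊗ₜ[K] a)) = _
    rw [LinearMap.baseChange_tmul, TensorProduct.AlgebraTensorModule.rid_tmul, Algebra.smul_def]
  -- `TL` is the sum of the traces of the components
  have hTL' : ∀ z : L ⊗[K] A, TL z = ∑ i, Matrix.trace (e z i) := by
    intro z
    induction z with
    | zero => simp
    | tmul c a =>
      have hca : (c ⊗ₜ[K] a : L ⊗[K] A) = c • ((1 : L) ⊗ₜ[K] a) := by
        rw [TensorProduct.smul_tmul', smul_eq_mul, mul_one]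
      rw [hTL, hca, map_smul]
      simp only [Pi.smul_apply, Matrix.trace_smul, smul_eq_mul]
      rw [← Finset.mul_sum, ← he a, mul_comm]
    | add z w hz hw =>
      rw [map_add, hz, hw, map_add]
      simp only [Pi.add_apply, Matrix.trace_add]
      rw [Finset.sum_add_distrib]
  -- `TL ((1 ⊗ x) z) = 0` for all `z`
  have hzero : ∀ z : L ⊗[K] A, TL (((1 : L) ⊗ₜ[K] x) * z) = 0 := by
    intro z
    induction z with
    | zero => rw [mul_zero, map_zero]
    | tmul c y =>
      rw [Algebra.TensorProduct.tmul_mul_tmul, one_mul, hTL, hx, map_zero, zero_mul]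
    | add z w hz hw => rw [mul_add, map_add, hz, hw, add_zero]
  -- hence all entries of `e (1 ⊗ x)` vanish
  set m := e ((1 : L) ⊗ₜ[K] x) with hm
  have hentry : ∀ (i : ι) (j k : Fin (n i)), m i j k = 0 := by
    classical
    intro i j k
    have h1 : TL (((1 : L) ⊗ₜ[K] x) * e.symm (Pi.single i (Matrix.single k j 1))) = 0 := hzero _
    rw [hTL', map_mul, AlgEquiv.apply_symm_apply, ← hm, Finset.sum_eq_single i] at h1
    · rw [Pi.mul_apply, Pi.single_eq_same, Matrix.trace, Finset.sum_eq_single j] at h1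
      · rw [Matrix.diag_apply, Matrix.mul_single_apply_same, mul_one] at h1
        exact h1
      · intro b _ hb
        rw [Matrix.diag_apply, Matrix.mul_single_apply_of_ne (1 : L) k j b b hb (m i)]
      · intro h
        exact absurd (Finset.mem_univ j) h
    · intro i' _ hi'
      rw [Pi.mul_apply, Pi.single_eq_of_ne hi', mul_zero, Matrix.trace_zero]
    · intro h
      exact absurd (Finset.mem_univ i) h
  have hm0 : m = 0 := by
    funext i
    ext j k
    rw [hentry]
    rfl
  have hex : e ((1 : L) ⊗ₜ[K] x) = 0 := by
    rw [← hm, hm0]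
  have h1x : ((1 : L) ⊗ₜ[K] x : L ⊗[K] A) = 0 := (map_eq_zero_iff e e.injective).mp hex
  have hinj : Function.Injective (Algebra.TensorProduct.includeRight : A →ₐ[K] L ⊗[K] A) :=
    Algebra.TensorProduct.includeRight_injective (algebraMap K L).injective
  apply hinj
  rw [map_zero]
  exact h1x

/-- An `R`-linear functional on an `R`-order `𝒪 ⊆ A` extends to a `K`-linear functional on `A` (`K = Frac R`): choose a
`K`-basis of `A` inside `𝒪` and clear denominators. [folklore] -/
private theorem exists_dual_extension [Nontrivial R] [IsFractionRing R K] {O : Subalgebra R A}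
    (hord : IsOrder R K A O)
    (φ : O →ₗ[R] R) : ∃ Φ : A →ₗ[K] K, ∀ x : O, Φ x = algebraMap R K (φ x) := by
  classical
  haveI : Submodule.IsLattice K (Subalgebra.toSubmodule O) := hord
  have hRK : Function.Injective (algebraMap R K) := IsFractionRing.injective R K
  -- a `K`-basis of `A` inside `O`
  obtain ⟨t, ht, hspan, hli⟩ := exists_linearIndependent K (O : Set A)
  have htop : ⊤ ≤ Submodule.span K (Set.range ((↑) : t → A)) := by
    rw [Subtype.range_coe, hspan]
    exact (Submodule.IsLattice.span_eq_top (M := Subalgebra.toSubmodule O)).ge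
  let b : Module.Basis t K A := Module.Basis.mk hli htop
  have hb : ∀ i, b i ∈ O := fun i => by
    rw [Module.Basis.mk_apply]
    exact ht i.2
  let Φ : A →ₗ[K] K := b.constr K fun i => algebraMap R K (φ ⟨b i, hb i⟩)
  have hΦb : ∀ i, Φ (b i) = algebraMap R K (φ ⟨b i, hb i⟩) := fun i => by
    simp only [Φ, Module.Basis.constr_basis]
  refine ⟨Φ, fun x => ?_⟩
  -- clear denominators in the coordinates of `x`
  obtain ⟨d, hd⟩ := IsLocalization.exist_integer_multiples (nonZeroDivisors R) (b.repr (x : A)).support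
    (fun i => b.repr (x : A) i)
  have hcoef : ∀ i ∈ (b.repr (x : A)).support, ∃ r : R, algebraMap R K r = (d : R) • b.repr (x : A) i :=
    fun i hi => RingHom.mem_rangeS.mp (hd i hi)
  choose! r hr using hcoef
  -- `d • x = ∑ rᵢ • bᵢ` with `rᵢ ∈ R`
  have hdx : ((d : R) • (x : A)) = ∑ i ∈ (b.repr (x : A)).support, r i • (b i : A) := by
    conv_lhs => rw [← b.linearCombination_repr (x : A), Finsupp.linearCombination_apply, Finsupp.sum,
      Finset.smul_sum]
    refine Finset.sum_congr rfl fun i hi => ?_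
    rw [← smul_assoc, ← hr i hi, algebraMap_smul]
  have hdxO : (d : R) • x = ∑ i ∈ (b.repr (x : A)).support, r i • (⟨b i, hb i⟩ : O) := by
    apply Subtype.ext
    have h2 : (((∑ i ∈ (b.repr (x : A)).support, r i • (⟨b i, hb i⟩ : O) : O)) : A) =
        ∑ i ∈ (b.repr (x : A)).support, r i • (b i : A) := by
      have := map_sum (O.val : O →ₐ[R] A) (fun i => r i • (⟨b i, hb i⟩ : O)) (b.repr (x : A)).support
      simp only [map_smul, Subalgebra.coe_val] at this
      exact this
    rw [h2, ← hdx]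
    rfl
  -- compare `Φ (d • x)` and `algebraMap (φ (d • x))`
  have hΦx : Φ ((d : R) • (x : A)) = algebraMap R K (φ ((d : R) • x)) := by
    rw [hdx, hdxO, map_sum, map_sum, map_sum]
    refine Finset.sum_congr rfl fun i _ => ?_
    rw [LinearMap.map_smul_of_tower, hΦb, map_smul, smul_eq_mul, map_mul, Algebra.smul_def]
  rw [LinearMap.map_smul_of_tower, map_smul, smul_eq_mul, map_mul, Algebra.smul_def] at hΦx
  exact mul_left_cancel₀ (IsFractionRing.to_map_ne_zero_of_mem_nonZeroDivisors d.2) hΦx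

end Holds1119

/-- **Lemma 1.1.1.9 HOLDS** (discharge of `Lan2013_1119`): for an `R`-order `𝒪` that is projective (= locally free) over the
noetherian domain `R`, with `Tr` the reduced trace of `A`: `Diff⁻¹` is finitely generated projective, `Tr : 𝒪 × Diff⁻¹ → R` is a
perfect pairing (both curried maps bijective), and an `R`-basis of `𝒪` has a unique `Tr`-dual basis of `Diff⁻¹`.  Proof:
the reduced trace form is symmetric and nondegenerate (`IsReducedTrace.apply_mul_comm`,
`IsReducedTrace.eq_zero_of_forall_apply_mul_eq_zero`), so `y ↦ Tr(· y)` is a `K`-isomorphism `A ≅ A^*`; `R`-functionals on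
`𝒪` extend to `K`-functionals on `A` (`exists_dual_extension`), whence `Diff⁻¹ ≅ Hom_R(𝒪, R)` (finitely generated projective,
Mathlib `dual_finite` ∕ `dual_projective`); the converse pairing is the reflexivity of the finitely generated projective `𝒪`
(`Module.evalEquiv`), and the dual basis is `Module.Basis.dualBasis` transported.  The hypothesis `IsSeparableAlgebra K A` is
carried, not used (nondegeneracy comes from the splitting in `IsReducedTrace`).
[cite: Lan2013PELCompactifications, Lem. 1.1.1.9 (p. 3; 2010 rev. pp. 3–4)] -/
theorem Lan2013_1119_holds : Lan2013_1119.{u} := by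
  intro R _ _ _ K _ _ _ A _ _ _ _ _ Tr O _ hTr hord hproj
  classical
  haveI : Submodule.IsLattice K (Subalgebra.toSubmodule O) := hord
  haveI := hproj
  have hRK : Function.Injective (algebraMap R K) := IsFractionRing.injective R K
  -- `𝒪` is finitely generated over `R`
  haveI : Module.Finite R O := by
    let eO : Subalgebra.toSubmodule O ≃ₗ[R] O :=
      { toFun := fun x => ⟨x.1, x.2⟩
        invFun := fun x => ⟨x.1, x.2⟩
        map_add' := fun _ _ => rfl
        map_smul' := fun _ _ => rfl
        left_inv := fun _ => rfl
        right_inv := fun _ => rfl }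
    exact Module.Finite.equiv eO
  -- the inverse different, as a set
  set D := inverseDifferent R K A Tr O with hDdef
  have hD : ∀ z : A, z ∈ D ↔ ∀ y ∈ O, Tr (z * y) ∈ (algebraMap R K).range := by
    intro z
    let S' : Submodule R A :=
      { carrier := {x : A | ∀ y ∈ O, Tr (x * y) ∈ (algebraMap R K).range}
        add_mem' := fun {a b} ha hb y hy => by
          rw [add_mul, map_add]
          exact (algebraMap R K).range.add_mem (ha y hy) (hb y hy)
        zero_mem' := fun y _ => by
          rw [zero_mul, map_zero]
          exact (algebraMap R K).range.zero_mem
        smul_mem' := fun c {a} ha y hy => by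
          rw [smul_mul_assoc, LinearMap.map_smul_of_tower, Algebra.smul_def]
          exact (algebraMap R K).range.mul_mem ⟨c, rfl⟩ (ha y hy) }
    have hS' : D = S' := by
      rw [hDdef, inverseDifferent]
      exact Submodule.span_eq S'
    rw [hS']
    exact Iff.rfl
  -- symmetric version of membership
  have hD' : ∀ z : A, z ∈ D ↔ ∀ y ∈ O, Tr (y * z) ∈ (algebraMap R K).range := by
    intro z
    rw [hD]
    exact forall₂_congr fun y _ => by rw [hTr.apply_mul_comm]
  -- the `K`-isomorphism `A ≅ Dual K A`, `y ↦ Tr(· y)`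
  let B : A →ₗ[K] Module.Dual K A := ((LinearMap.mul K A).compr₂ Tr).flip
  have hB : ∀ x y : A, B y x = Tr (x * y) := fun _ _ => rfl
  have hBinj : Function.Injective B := by
    intro y y' h
    rw [← sub_eq_zero]
    apply hTr.eq_zero_of_forall_apply_mul_eq_zero
    intro x
    rw [hTr.apply_mul_comm, mul_sub, map_sub, sub_eq_zero, ← hB, ← hB, h]
  have hBsurj : Function.Surjective B :=
    (LinearMap.injective_iff_surjective_of_finrank_eq_finrank (Subspace.dual_finrank_eq).symm).mp hBinj
  have hspanO : Submodule.span K (O : Set A) = ⊤ :=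
    Submodule.IsLattice.span_eq_top (M := Subalgebra.toSubmodule O)
  -- (b) uniqueness: an element of `A` is determined by `Tr(x ·)`, `x ∈ 𝒪`
  have hb_unique : ∀ z z' : A, (∀ x : O, Tr ((x : A) * z) = Tr ((x : A) * z')) → z = z' := by
    intro z z' h
    apply hBinj
    refine LinearMap.ext_on hspanO fun x hx => ?_
    rw [hB, hB]
    exact h ⟨x, hx⟩
  -- (b) existence
  have hb_exists : ∀ φ : O →ₗ[R] R, ∃ y : A, y ∈ D ∧ ∀ x : O, algebraMap R K (φ x) = Tr ((x : A) * y) := by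
    intro φ
    obtain ⟨Φ, hΦ⟩ := exists_dual_extension hord φ
    obtain ⟨y, hy⟩ := hBsurj Φ
    refine ⟨y, (hD' y).mpr fun x hx => ⟨φ ⟨x, hx⟩, ?_⟩, fun x => ?_⟩
    · rw [← hΦ ⟨x, hx⟩, ← hy]
      rfl
    · rw [← hΦ x, ← hy]
      rfl
  -- the `R`-linear map `β : Diff⁻¹ → Hom_R(𝒪, R)`, `z ↦ Tr(· z)`
  have key : ∀ (z : D) (x : O), ∃ r : R, algebraMap R K r = Tr ((x : A) * (z : A)) :=
    fun z x => ((hD' (z : A)).mp z.2) x x.2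
  choose βf hβf using key
  let β : D →ₗ[R] Module.Dual R O :=
    { toFun := fun z =>
        { toFun := fun x => βf z x
          map_add' := fun x x' => hRK (by
            rw [hβf, map_add (algebraMap R K), hβf, hβf, Subalgebra.coe_add, add_mul, map_add])
          map_smul' := fun c x => hRK (by
            rw [hβf, RingHom.id_apply, smul_eq_mul, map_mul (algebraMap R K), hβf, Subalgebra.coe_smul,
              smul_mul_assoc, LinearMap.map_smul_of_tower, Algebra.smul_def]) }
      map_add' := fun z z' => by
        ext x
        apply hRK
        rw [LinearMap.add_apply]
        change algebraMap R K (βf (z + z') x) = algebraMap R K (βf z x + βf z' x)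
        rw [hβf, map_add (algebraMap R K), hβf, hβf, Submodule.coe_add, mul_add, map_add]
      map_smul' := fun c z => by
        ext x
        apply hRK
        rw [LinearMap.smul_apply, RingHom.id_apply]
        change algebraMap R K (βf (c • z) x) = algebraMap R K (c • βf z x)
        rw [hβf, smul_eq_mul, map_mul (algebraMap R K), hβf, Submodule.coe_smul, mul_smul_comm,
          LinearMap.map_smul_of_tower, Algebra.smul_def] }
  have hβ : ∀ (z : D) (x : O), algebraMap R K (β z x) = Tr ((x : A) * (z : A)) := hβf
  have hβinj : Function.Injective β := by
    intro z z' h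
    apply Subtype.ext
    refine hb_unique _ _ fun x => ?_
    rw [← hβ, ← hβ, h]
  have hβsurj : Function.Surjective β := by
    intro φ
    obtain ⟨y, hyD, hy⟩ := hb_exists φ
    refine ⟨⟨y, hyD⟩, ?_⟩
    ext x
    apply hRK
    rw [hβ, ← hy]
  let β' : D ≃ₗ[R] Module.Dual R O := LinearEquiv.ofBijective β ⟨hβinj, hβsurj⟩
  have hβ' : ∀ z : D, β' z = β z := fun _ => rfl
  refine ⟨⟨Module.Finite.equiv β'.symm, Module.Projective.of_equiv β'.symm⟩, ?_, ?_, ?_⟩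
  · -- (b)
    intro φ
    obtain ⟨y, hyD, hy⟩ := hb_exists φ
    refine ⟨⟨y, hyD⟩, hy, fun y' hy' => Subtype.ext (hb_unique _ _ fun x => ?_)⟩
    rw [← hy' x, ← hy x]
  · -- (c): by reflexivity of the finitely generated projective `𝒪`
    intro ψ
    let η : Module.Dual R (Module.Dual R O) := ψ ∘ₗ β'.symm.toLinearMap
    have hη : ∀ z : D, η (β z) = ψ z := fun z => by
      change ψ (β'.symm (β' z)) = ψ z
      rw [LinearEquiv.symm_apply_apply]
    let x₀ : O := (Module.evalEquiv R O).symm η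
    have hx₀ : ∀ f : Module.Dual R O, f x₀ = η f := fun f => Module.apply_evalEquiv_symm_apply R O f η
    refine ⟨x₀, fun y => ?_, fun x' hx' => ?_⟩
    · rw [← hβ y x₀, hx₀ (β y), hη]
    · apply (Module.evalEquiv R O).injective
      rw [LinearEquiv.apply_symm_apply]
      ext f
      rw [Module.evalEquiv_apply, Module.Dual.eval_apply]
      obtain ⟨z, rfl⟩ := hβsurj f
      rw [hη]
      apply hRK
      rw [hβ, ← hx' z]
  · -- (d): the dual basis
    intro ι _ _ e
    let f : Module.Basis ι R D := e.dualBasis.map β'.symm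
    have hf : ∀ i j, Tr ((e i : A) * (f j : A)) = if i = j then 1 else 0 := by
      intro i j
      rw [← hβ (f j) (e i)]
      have hfj : β (f j) = e.dualBasis j := by
        change β (β'.symm (e.dualBasis j)) = _
        rw [← hβ', LinearEquiv.apply_symm_apply]
      rw [hfj, Module.Basis.dualBasis_apply_self]
      split_ifs
      · exact map_one _
      · exact map_zero _
    refine ⟨f, hf, fun f' hf' => ?_⟩
    apply Module.Basis.eq_of_apply_eq
    intro j
    apply β'.injective
    rw [hβ', hβ']
    refine Module.Basis.ext e fun i => ?_
    apply hRK
    rw [hβ, hβ, hf, hf']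

/-- **Proposition 1.1.1.16 HOLDS** (discharge of `Lan2013_11116`; `R` Dedekind): (1) the different `Diff_{𝒪/R}` is
contained in `𝒪` (because `1 ∈ Diff⁻¹`: reduced traces of elements of the order lie in the normal domain `R`,
`IsReducedTrace.apply_mem_range`) and is two-sided (`Diff⁻¹` is a two-sided `𝒪`-module, by the symmetry of the trace form);
(2) in the free form of Lan's proof of (1.1.1.17): if `e` is an `R`-basis of `𝒪`, `f` the `Tr`-dual basis of `Diff⁻¹` and
`eᵢ = ∑ⱼ aᵢⱼ fⱼ`, then `Tr(eᵢ eⱼ) = aᵢⱼ`, so by Remark 1.1.1.7 (`Lan2013_1117_holds`, after re-indexing the basis by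
`Fin [A : K]` — an `R`-basis of a full lattice has `[A : K]` elements, `Submodule.IsLattice.rank'`)
`Disc_{𝒪/R} = (det(Tr(eᵢ eⱼ))) = (det a)`. [cite: Lan2013PELCompactifications, Prop. 1.1.1.16 (p. 4; 2010 rev. p. 5)] -/
theorem Lan2013_11116_holds : Lan2013_11116.{u} := by
  intro R _ _ K _ _ _ A _ _ _ _ _ Tr O hsep hTr hord
  classical
  haveI : Submodule.IsLattice K (Subalgebra.toSubmodule O) := hord
  have hRK : Function.Injective (algebraMap R K) := IsFractionRing.injective R K
  have hfg : (Subalgebra.toSubmodule O).FG := Submodule.IsLattice.fg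
  -- membership in `Diff⁻¹`
  set D := inverseDifferent R K A Tr O with hDdef
  have hD : ∀ z : A, z ∈ D ↔ ∀ y ∈ O, Tr (z * y) ∈ (algebraMap R K).range := by
    intro z
    let S' : Submodule R A :=
      { carrier := {x : A | ∀ y ∈ O, Tr (x * y) ∈ (algebraMap R K).range}
        add_mem' := fun {a b} ha hb y hy => by
          rw [add_mul, map_add]
          exact (algebraMap R K).range.add_mem (ha y hy) (hb y hy)
        zero_mem' := fun y _ => by
          rw [zero_mul, map_zero]
          exact (algebraMap R K).range.zero_mem
        smul_mem' := fun c {a} ha y hy => by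
          rw [smul_mul_assoc, LinearMap.map_smul_of_tower, Algebra.smul_def]
          exact (algebraMap R K).range.mul_mem ⟨c, rfl⟩ (ha y hy) }
    have hS' : D = S' := by
      rw [hDdef, inverseDifferent]
      exact Submodule.span_eq S'
    rw [hS']
    exact Iff.rfl
  -- membership in `Diff`
  set Df := different R K A Tr O with hDfdef
  have hDf : ∀ z : A, z ∈ Df ↔ ∀ y ∈ D, z * y ∈ O := by
    intro z
    let S' : Submodule R A :=
      { carrier := {x : A | ∀ y ∈ D, x * y ∈ O}
        add_mem' := fun {a b} ha hb y hy => by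
          rw [add_mul]
          exact O.add_mem (ha y hy) (hb y hy)
        zero_mem' := fun y _ => by
          rw [zero_mul]
          exact O.zero_mem
        smul_mem' := fun c {a} ha y hy => by
          rw [smul_mul_assoc]
          exact O.smul_mem (ha y hy) c }
    have hS' : Df = S' := by
      rw [hDfdef, different]
      exact Submodule.span_eq S'
    rw [hS']
    exact Iff.rfl
  -- `1 ∈ Diff⁻¹`: reduced traces of elements of the order lie in `R`
  have h1D : (1 : A) ∈ D := by
    rw [hD]
    intro y hy
    rw [one_mul]
    exact hTr.apply_mem_range (IsIntegral.of_mem_of_fg O hfg y hy)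
  -- `Diff⁻¹` is a two-sided `𝒪`-module
  have hDO : ∀ x ∈ O, ∀ y ∈ D, x * y ∈ D := by
    intro x hx y hy
    rw [hD] at hy ⊢
    intro w hw
    rw [hTr.apply_mul_comm, ← mul_assoc, hTr.apply_mul_comm]
    exact hy _ (O.mul_mem hw hx)
  refine ⟨⟨fun z hz => ?_, fun z hz x hx => ⟨?_, ?_⟩⟩, ?_⟩
  · -- `Diff ≤ 𝒪`
    have := (hDf z).mp hz 1 h1D
    rwa [mul_one] at this
  · -- `x z ∈ Diff`
    rw [hDf] at hz ⊢
    intro y hy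
    rw [mul_assoc]
    exact O.mul_mem hx (hz y hy)
  · -- `z x ∈ Diff`
    rw [hDf] at hz ⊢
    intro y hy
    rw [mul_assoc]
    exact hz _ (hDO x hx y hy)
  -- (1.1.1.17) in the free form
  intro ι _ _ e f a hef hea
  -- the Gram matrix of `e` is `a`
  have hgram : ∀ i j, Tr ((e i : A) * (e j : A)) = algebraMap R K (a i j) := by
    intro i j
    rw [hea i, Finset.sum_mul, map_sum]
    simp_rw [smul_mul_assoc, LinearMap.map_smul_of_tower]
    rw [Finset.sum_eq_single j]
    · rw [hTr.apply_mul_comm, hef, if_pos rfl, Algebra.smul_def, mul_one]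
    · intro k _ hk
      rw [hTr.apply_mul_comm, hef, if_neg (Ne.symm hk), smul_zero]
    · intro h
      exact absurd (Finset.mem_univ j) h
  -- re-index `e` by `Fin [A : K]`
  have hcard : Fintype.card ι = Module.finrank K A := by
    -- the `R`-basis `e` of the full lattice `𝒪` is a `K`-basis of `A`
    have hli : LinearIndependent K (fun i => (e i : A)) := by
      rw [← LinearIndependent.iff_fractionRing R K]
      exact e.linearIndependent.map' (O.val.toLinearMap) (LinearMap.ker_eq_bot.mpr Subtype.val_injective)
    have hsp : ⊤ ≤ Submodule.span K (Set.range fun i => (e i : A)) := by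
      rw [← Submodule.IsLattice.span_eq_top (M := Subalgebra.toSubmodule O), Submodule.span_le]
      intro x hx
      have h1 : x ∈ Submodule.span R (Set.range fun i => (e i : A)) := by
        have h2 := Submodule.mem_map_of_mem (f := O.val.toLinearMap) (e.mem_span ⟨x, hx⟩)
        rw [Submodule.map_span, ← Set.range_comp] at h2
        exact h2
      exact Submodule.span_subset_span R K _ h1
    exact (Module.finrank_eq_card_basis (Module.Basis.mk hli hsp)).symm
  let σ : ι ≃ Fin (Module.finrank K A) := Fintype.equivFinOfCardEq hcard
  let e' : Module.Basis (Fin (Module.finrank K A)) R O := e.reindex σ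
  have h1117 := Lan2013_1117_holds R K A Tr O e' inferInstance hsep hTr hord
  -- `det (Tr (e'ᵢ e'ⱼ)) = det (Tr (eᵢ eⱼ)) = algebraMap (det a)`
  have hdet : (Matrix.of fun i j => Tr ((e' i : A) * (e' j : A))).det = algebraMap R K a.det := by
    have hsub : (Matrix.of fun i j => Tr ((e' i : A) * (e' j : A))) =
        (a.map (algebraMap R K)).submatrix σ.symm σ.symm := by
      ext i j
      simp only [Matrix.of_apply, Matrix.submatrix_apply, Matrix.map_apply, e', Module.Basis.reindex_apply, hgram]
    rw [hsub, Matrix.det_submatrix_equiv_self, ← RingHom.mapMatrix_apply, ← RingHom.map_det]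
  rw [hdet] at h1117
  -- `Disc = comap (map Disc) = comap (span {algebraMap (det a)}) = span {det a}`
  have hinj : Function.Injective (Algebra.linearMap R K) := hRK
  calc discr R K A Tr O
      = Submodule.comap (Algebra.linearMap R K) (Submodule.map (Algebra.linearMap R K) (discr R K A Tr O)) :=
        (Submodule.comap_map_eq_of_injective hinj _).symm
    _ = Submodule.comap (Algebra.linearMap R K) (Submodule.span R {algebraMap R K a.det}) := by rw [h1117]
    _ = Ideal.span {a.det} := by
        have hmap : Submodule.map (Algebra.linearMap R K) (Ideal.span {a.det}) =
            Submodule.span R {algebraMap R K a.det} := by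
          rw [Ideal.span, Submodule.map_span, Set.image_singleton]
          rfl
        rw [← hmap, Submodule.comap_map_eq_of_injective hinj]

end Literature.AlgebraicGeometry.ModuliOfAbelianVarieties.Lan2013.Sec11PreliminariesAlgebra
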